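import Summits.BirchSwinnertonDyer.BirchSwinnertonDyer.Theses.SemiOrdinaryEisensteinDescent
import Summits.BirchSwinnertonDyer.BirchSwinnertonDyer.Theorems.SemiOrdinaryEisensteinDescentEisensteinKernelAtThreeOfValueAtOneV
import Summits.BirchSwinnertonDyer.BirchSwinnertonDyer.Theorems.SemiOrdinaryEisensteinDescentJetchevMaxDivisibilityAtThreeModThree
import Summits.BirchSwinnertonDyer.BirchSwinnertonDyer.Theorems.SemiOrdinaryEisensteinDescentCasselsTateOfShaTwoCochain
import Summits.BirchSwinnertonDyer.BirchSwinnertonDyer.Theorems.SchneiderFreeAdditiveX3PoitouTateSelmerDualityHolds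
import HarnessLib

/-!
# Route `SemiOrdinaryEisensteinDescent` (rev 25): the `closes` kernel AFTER the Poitou–Tate event — six binders
# {PUB, E_𝟙^V, Kolyvagin primitives, J‴, Hsieh ∧ BDP ∧ LZZ, Z}, every Poitou–Tate / Jetchev-max / glue binder DISCHARGED
# (width seat `bsd-wall-soed-p2-w3` g6; `--supports stmt-BirchSwinnertonDyer-25898`, helper)

EVENT (2026-08-28). Cell bsd-schneider's Route A landed Poitou–Tate duality for Selmer structures at every number field
(`SchneiderFreeAdditiveX3.PoitouTateReduction.poitouTate_selmerStructure_duality_holds`, p624636 — item 20461 PT1 CLOSED by p625477) and Howard's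
complement property of THE canonical local invariant maps (`selmerComplement_canonical_holds`, p626891); this seat then closed the tree-debt item
25897 `JetchevMaxDivisibilityAtThreeModThree` (p628853) and reduced the Cassels–Tate print item 20191 for THE maps to the Ш²-cochain form of Milne I 4.10(a)
alone (`CasselsTateConj.casselsTate_levelInputs_of_shaTwoCochain`, p628097). The route's deciding theorem
`closes (hIn) (hE1V) (hPr) (hPTc) (hGJ) (hJ) (hW) (hZ) (hK)` therefore has THREE dischargeable binders — `hPTc` (23092, PT⁵ ∀K, a theorem:
INPUTS tranche #3b), `hGJ` (26257 ✓) and the PT⁴/Jmax antecedents inside `hK` (26611 ✓) — and the honest post-event kernel is: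

* `wAllExclAddWildRankOneSurj_of_valueAtOneV_of_primitives_of_sigmaMultiCarrier` — **`PublishedInputsWildThree → WildSplitEisensteinValueAtOneV →
  KolyvaginPrimitivesAtThree → WildSigmaDivisibilityAtThreeMultiCarrier → WildSplitPrintedInputsAtThree → WildRankZeroTwistAtThree →
  WAllExclAddWildRankOneSurj`** (kernel-V p609065 §3 with `hJmax := semiOrdinaryEisensteinDescent_jetchevMaxDivisibilityAtThreeModThree_proof` and
  `hPT := poitouTate_selmerStructure_duality_holds`); a candidate `closes` re-key for the pen (six binders: 3 print {hIn, hPr, hW} + 3 research {hE1V, hJ, hZ});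
* `wAllExclAddWildRankOneSurj_of_valueAtOneV_of_shaTwoCochain_of_twoPrintFacts_of_sigmaMultiCarrier` — the same with the print package
  `KolyvaginPrimitivesAtThree = CT ∧ 3.7(2) ∧ E0` OPENED to its true residual: **{Ш²-cochain form of Milne I 4.10(a) (∀ K), Gross 1991 Prop. 3.7 (2),
  Gross 1991 E0}** (CT ⟸ Ш² alone by p628097);
* `kolyvaginPrimitivesAtThree_of_shaTwoCochain_of_twoPrintFacts` — **item 25896 `KolyvaginPrimitivesAtThree` BY NAME ⟸ {Ш²-cochain ∀ K, 3.7(2), E0}**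
  (its residual display; the item stays open until those three are theorems).

HONEST FRAMING. Implications between named route statements; every antecedent that is not a theorem stays displayed. The research cruxes
E_𝟙^V (26610), J‴ (25898; after p628688 its line reads ⟸ E0 + 3.7(2) + stub_maninThree + stub_flatMultiCarrier), Z (20387) are untouched; the print
packages PUB (GZ, Kolyvagin, GZK, modularity, …) and W (Hsieh, BDP, LZZ) are untouched; nothing about any curve is asserted unconditionally; no case of
Poitou–Tate duality is proved IN THIS FILE (consumed by name). BSD is not proved by this file.

References: [cite: JetchevSkinnerWan2017, Thm. 3.3.1 and §7.4.1 (arXiv:1512.06894 pp. 11, 30)] [cite: Jetchev2008, Thm. 1.4 (p. 812)]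
[cite: MilneADT2006, Ch. I, Thm. 4.10 (a)(b), §6 Prop. 6.9] [cite: Howard2004HeegnerKolyvagin, Thm. 2.1.11 (arXiv:1202.6340 p. 6)]
[cite: GrossLMS1991, Prop. 3.7 (2) p. 240, §5 (5.1), §6 p. 245] [cite: McCallumLMS1991, §3, §5 Thm. 5.4/5.8]
-/

noncomputable section

open scoped Classical NumberField

set_option linter.dupNamespace false -- `Summit.BirchSwinnertonDyer.BirchSwinnertonDyer.Theorems.…` (summit = sub, D-0017)
set_option autoImplicit false

namespace Summit.BirchSwinnertonDyer.BirchSwinnertonDyer.Theorems.EisensteinKernelAtThreeOfValueAtOneVSlim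

open WeierstrassCurve NumberField IsDedekindDomain Field
open Literature.NumberTheory.EllipticCurves Literature.NumberTheory.GaloisRepresentations Literature.NumberTheory.GaloisCohomology
open Literature.NumberTheory.GaloisRepresentations.DiscreteGaloisModule (SelmerStructure unramifiedSubgroup localTatePairingZMod tateDual)
open Summit.BirchSwinnertonDyer.BirchSwinnertonDyer.Theses.SemiOrdinaryEisensteinDescent
open Summit.BirchSwinnertonDyer.BirchSwinnertonDyer.Theorems.EisensteinKernelAtThreeOfValueAtOneV
open Summit.BirchSwinnertonDyer.BirchSwinnertonDyer.Theorems.SchneiderFreeAdditiveX3.PoitouTateReduction (poitouTate_selmerStructure_duality_holds)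
open Summit.BirchSwinnertonDyer.BirchSwinnertonDyer.Theorems.CasselsTateConj (casselsTate_levelInputs_of_shaTwoCochain)

/-! ## §1 The six-binder kernel (every Poitou–Tate / Jetchev-max / glue binder of `closes` discharged) -/

/-- **`PublishedInputsWildThree → WildSplitEisensteinValueAtOneV → KolyvaginPrimitivesAtThree → WildSigmaDivisibilityAtThreeMultiCarrier →
WildSplitPrintedInputsAtThree → WildRankZeroTwistAtThree → WAllExclAddWildRankOneSurj`** — kernel-V (p609065 §3,
`wAllExclAddWildRankOneSurj_of_valueAtOneV_of_sigmaMultiCarrier_of_jetchevMaxModThree_of_primitives_of_poitouTate`) with its Jetchev-max binder fed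
by the CLOSED item 25897 (`semiOrdinaryEisensteinDescent_jetchevMaxDivisibilityAtThreeModThree_proof`, p628853) and its PT1 binder by cell bsd-schneider's
`poitouTate_selmerStructure_duality_holds` (p624636). = the route's `closes` with `hPTc`, `hGJ`, `hK` inlined as theorems. CONDITIONAL on the six displayed
route statements; closes nothing by itself; BSD for no curve. [cite: JetchevSkinnerWan2017, Thm. 3.3.1 and §7.4.1 (arXiv:1512.06894 pp. 11, 30)]
[cite: Jetchev2008, Thm. 1.4 (p. 812)] [cite: MilneADT2006, Ch. I, Thm. 4.10(b)] -/
theorem wAllExclAddWildRankOneSurj_of_valueAtOneV_of_primitives_of_sigmaMultiCarrier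
    (hF : PublishedInputsWildThree) (hE1V : WildSplitEisensteinValueAtOneV) (hPr : KolyvaginPrimitivesAtThree)
    (hJ : WildSigmaDivisibilityAtThreeMultiCarrier) (hW : WildSplitPrintedInputsAtThree) (hZ : WildRankZeroTwistAtThree) :
    Summit.BirchSwinnertonDyer.WAllExclAddWildRankOneSurj :=
  wAllExclAddWildRankOneSurj_of_valueAtOneV_of_sigmaMultiCarrier_of_jetchevMaxModThree_of_primitives_of_poitouTate hF hE1V hPr
    semiOrdinaryEisensteinDescent_jetchevMaxDivisibilityAtThreeModThree_proof hJ hW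
    (fun K _ _ ↦ poitouTate_selmerStructure_duality_holds K) hZ

/-! ## §2 Item 25896 `KolyvaginPrimitivesAtThree` BY NAME from its true residual -/

/-- **`KolyvaginPrimitivesAtThree` (stmt-BirchSwinnertonDyer-25896 = CT 20191 ∧ 3.7(2) 23091 ∧ E0 24701) BY NAME ⟸ {the Ш²-cochain form of Milne I
4.10(a) at every number field (`hSha`, the `hPTc` binder of `CasselsTateConj.casselsTate_levelInputs_of_shaTwoCochain`), Gross 1991 Prop. 3.7 (2),
Gross 1991 E0}** — CT(K) for THE maps follows from `hSha K` alone (p628097; reciprocity, local duality, `Ш³ = 0`, Lemma 6.15, `Aut(K/ℚ)`-invariance and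
the Poitou–Tate input being theorems). The item's residual display; it stays open until the three are theorems. CONDITIONAL; BSD for no curve.
[cite: MilneADT2006, Ch. I, Thm. 4.10 (a), §6 Prop. 6.9, Thm. 6.13] [cite: GrossLMS1991, Prop. 3.7 (2) p. 240, §5 (5.1), §6 p. 245] -/
theorem kolyvaginPrimitivesAtThree_of_shaTwoCochain_of_twoPrintFacts
    (hSha : ∀ (K : Type) [Field K] [NumberField K] (W : WeierstrassCurve ℚ) [W.IsElliptic] (p M₀ : ℕ), p.Prime → p ≠ 2 → 1 ≤ M₀ →
      ∀ [NeZero (p ^ M₀)]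
        (e : geomTorsion (W.baseChange K) ((p ^ M₀ * p ^ M₀ : ℕ) : ℤ) →
          geomTorsion (W.baseChange K) ((p ^ M₀ * p ^ M₀ : ℕ) : ℤ) → AlgebraicClosure K)
        (hμ : ∀ S T, e S T ^ (p ^ M₀ * p ^ M₀) = 1)
        (hadd₁ : ∀ S₁ S₂ T, e (S₁ + S₂) T = e S₁ T * e S₂ T)
        (hadd₂ : ∀ S T₁ T₂, e S (T₁ + T₂) = e S T₁ * e S T₂)
        (hgal : ∀ (σ : absoluteGaloisGroup K)
          (S T : geomTorsion (W.baseChange K) ((p ^ M₀ * p ^ M₀ : ℕ) : ℤ)), σ • e S T = e (σ • S) (σ • T)),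
        (∀ T, e T T = 1) → (∀ T, (∀ S, e S T = 1) → T = 0) →
        ∀ f : contTwoCocycles ((W.baseChange K).torsionGaloisModule ((p ^ M₀ : ℕ) : ℤ)).toTopRep,
          (∀ g : contOneCocycles ((W.baseChange K).torsionGaloisModule ((p ^ M₀ : ℕ) : ℤ)).toTopRep,
            (∀ v : Place K, locClass ((W.baseChange K).torsionGaloisModule ((p ^ M₀ : ℕ) : ℤ))
                (Place.Completion v)
                (resOne ((W.baseChange K).torsionGaloisModule ((p ^ M₀ : ℕ) : ℤ)) (Place.Completion v) g) = 0) →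
            ∃ (C : PTChoice (W.baseChange K) (p ^ M₀) e hμ hadd₁ hadd₂ hgal f g) (S : Finset (Place K)),
              (∀ v ∉ S, C.localTerm (LocalInvariants.canonical K (p ^ M₀ * p ^ M₀)) v = 0) ∧
                ∑ v ∈ S, C.localTerm (LocalInvariants.canonical K (p ^ M₀ * p ^ M₀)) v = 0) →
          twoCocycleClass _ f = 0)
    (h372 : GrossLMS1991.prop37_2_frobeniusCongruence) (hE0 : Gross1991_heegnerPoint_sub_ratTorsion_mem_E0) :
    KolyvaginPrimitivesAtThree :=
  ⟨fun K _ _ ↦ casselsTate_levelInputs_of_shaTwoCochain K (hSha K), h372, hE0⟩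

/-! ## §3 The kernel with the print package opened to its residual -/

/-- **The rung from {PUB, E_𝟙^V, Ш²-cochain ∀K, 3.7(2), E0, J‴, Hsieh ∧ BDP ∧ LZZ, Z}** — §1 ∘ §2: the SOED deciding chain with EVERY input displayed
at its post-event residual: print = {`PublishedInputsWildThree`, Ш²-cochain form of Milne I 4.10(a), Gross 3.7(2), Gross E0, `WildSplitPrintedInputsAtThree`},
research = {`WildSplitEisensteinValueAtOneV` 26610, `WildSigmaDivisibilityAtThreeMultiCarrier` 25898, `WildRankZeroTwistAtThree` 20387}. CONDITIONAL;
closes nothing; BSD for no curve. [cite: JetchevSkinnerWan2017, Thm. 3.3.1 and §7.4.1 (arXiv:1512.06894 pp. 11, 30)]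
[cite: MilneADT2006, Ch. I, Thm. 4.10 (a)(b)] [cite: GrossLMS1991, Prop. 3.7 (2) p. 240, §6 p. 245] -/
theorem wAllExclAddWildRankOneSurj_of_valueAtOneV_of_shaTwoCochain_of_twoPrintFacts_of_sigmaMultiCarrier
    (hF : PublishedInputsWildThree) (hE1V : WildSplitEisensteinValueAtOneV)
    (hSha : ∀ (K : Type) [Field K] [NumberField K] (W : WeierstrassCurve ℚ) [W.IsElliptic] (p M₀ : ℕ), p.Prime → p ≠ 2 → 1 ≤ M₀ →
      ∀ [NeZero (p ^ M₀)]
        (e : geomTorsion (W.baseChange K) ((p ^ M₀ * p ^ M₀ : ℕ) : ℤ) →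
          geomTorsion (W.baseChange K) ((p ^ M₀ * p ^ M₀ : ℕ) : ℤ) → AlgebraicClosure K)
        (hμ : ∀ S T, e S T ^ (p ^ M₀ * p ^ M₀) = 1)
        (hadd₁ : ∀ S₁ S₂ T, e (S₁ + S₂) T = e S₁ T * e S₂ T)
        (hadd₂ : ∀ S T₁ T₂, e S (T₁ + T₂) = e S T₁ * e S T₂)
        (hgal : ∀ (σ : absoluteGaloisGroup K)
          (S T : geomTorsion (W.baseChange K) ((p ^ M₀ * p ^ M₀ : ℕ) : ℤ)), σ • e S T = e (σ • S) (σ • T)),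
        (∀ T, e T T = 1) → (∀ T, (∀ S, e S T = 1) → T = 0) →
        ∀ f : contTwoCocycles ((W.baseChange K).torsionGaloisModule ((p ^ M₀ : ℕ) : ℤ)).toTopRep,
          (∀ g : contOneCocycles ((W.baseChange K).torsionGaloisModule ((p ^ M₀ : ℕ) : ℤ)).toTopRep,
            (∀ v : Place K, locClass ((W.baseChange K).torsionGaloisModule ((p ^ M₀ : ℕ) : ℤ))
                (Place.Completion v)
                (resOne ((W.baseChange K).torsionGaloisModule ((p ^ M₀ : ℕ) : ℤ)) (Place.Completion v) g) = 0) →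
            ∃ (C : PTChoice (W.baseChange K) (p ^ M₀) e hμ hadd₁ hadd₂ hgal f g) (S : Finset (Place K)),
              (∀ v ∉ S, C.localTerm (LocalInvariants.canonical K (p ^ M₀ * p ^ M₀)) v = 0) ∧
                ∑ v ∈ S, C.localTerm (LocalInvariants.canonical K (p ^ M₀ * p ^ M₀)) v = 0) →
          twoCocycleClass _ f = 0)
    (h372 : GrossLMS1991.prop37_2_frobeniusCongruence) (hE0 : Gross1991_heegnerPoint_sub_ratTorsion_mem_E0)
    (hJ : WildSigmaDivisibilityAtThreeMultiCarrier) (hW : WildSplitPrintedInputsAtThree) (hZ : WildRankZeroTwistAtThree) :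
    Summit.BirchSwinnertonDyer.WAllExclAddWildRankOneSurj :=
  wAllExclAddWildRankOneSurj_of_valueAtOneV_of_primitives_of_sigmaMultiCarrier hF hE1V
    (kolyvaginPrimitivesAtThree_of_shaTwoCochain_of_twoPrintFacts hSha h372 hE0) hJ hW hZ

end Summit.BirchSwinnertonDyer.BirchSwinnertonDyer.Theorems.EisensteinKernelAtThreeOfValueAtOneVSlim

end
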